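import Mathlib
import HarnessLib
import HarnessLib.Audit
import Literature.NumberTheory.LFunctions.JensenTuranCriterion

/-!
# Route `JensenPolynomials` — TYPED STATEMENTS of the JENSEN column (D-0040, ladder LADDER-RH §1 rows
J-C / J-D / J-P; director D-0059/D-0061): the RH-FREE PROOF-OF-DATA rungs on the hyperbolicity of the
Jensen polynomials `J^{d,n}_γ` of the Taylor coefficients `γ = xiTaylorCoeff` of `ξ` at `1/2`.

This file only NAMES objects and STATES claims as `Prop` constants in the tree's vocabulary (`jensenPoly`,
`xiTaylorCoeff`, `gorzHermite`), so that the column and its route can point at exact statements; it is the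
D-0016 extract of the theory seat's HOME scratch `run/shared/lean/pub/rh-jensen/rh-jensen-theory/JensenTargets.lean`
(v4.5, 3726 l., sha16 `84f4b4e9300ca469`, farm-checked, 0 sorry), which also holds the PROVED bookkeeping quoted
below (soundness of the sign test, the frame identity, the blueprint, the Turán-energy table) — those land as
separate `Theorems/JensenPolynomials*.lean` files by `--supports`.

LABELS (ladder rule §5.4). Every `Prop` below is a statement about the explicit real numbers `γ(n)`:
**RH-FREE** = provable (if true) without controlling zeros of `ζ`; by the tree's barrier entries
`Literature.Barriers.RiemannHypothesis.JensenPolynomials{,ShiftUniform,Sqrt}` (Farmer 2022) NO such statement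
carries information about RH — it is "proof of the data", not motion toward the summit. The only RH-EQUIVALENT
statement in this circle is hyperbolicity of ALL `J^{d,n}_γ` (`Literature…JensenPolyaCriterion`,
kernel `polya_jensen_holds`; Pólya 1927 / Csordas–Varga 1990), which is the column's DOOR (rung J-C) and is NOT
asserted or re-typed here. Nothing in this file bears on the truth of RH.

* §1 hyperbolicity RANGES: `TheoremAlpha` (rung J-P (P1): CAL-certified THEOREM α, `n ≥ max(10⁴, 0.135d³)`),
  `ExplicitGORTTWPow10` (P0′: `n ≥ 10^{2d+5}`, the prover seat's kernel chain `JensenXiExponentialRange`),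
  `ExplicitGORTTW1100` (P0), `JensenCubicRangeTwo` (P6's corollary: `n ≥ 2d³`).
* §2 GORTTW's frame [GriffinEtAl2022 §2] as functions of `γ`: `windowSeqDown`, `gorttwDeltaSq`, `gorttwR`,
  `gorttwQ` (the one function `q(M)`), `hermiteCoord`, `gorttwNormalised`, `gorttwCoeff`; `XiDeltaSqPos` (S-T5).
* §3 the HERMITE SIGN TEST: `HermiteSignTest`, `HermiteSignTestCubic` (P6, the round-4 proof-of-data target,
  certificate form), `HermiteSignTestSound` (S-H2, PROVED in HOME), `HermiteZeroBound` (S-H1, PROVED in HOME),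
  `HermiteCriticalRatioBound ρ` (S-H3 schema) with the PROVED table `rhoHT` and the candidate sharp table
  `rhoWin` (window table, PROVED in HOME) and the route's table `rhoWinMin` (window + bound-rows 5, 6, PROVED in HOME),
  `XiGorttwCoeffSmall ρ` (S-C schema) with its regime parts
  `XiGorttwCoeffSmallBelow/From ρ N`, `SignTestBlueprint ρ` (PROVED in HOME for every `ρ`).
-/

noncomputable section
set_option linter.dupNamespace false

namespace Summit.RiemannHypothesis.RiemannHypothesis.Theorems.JensenPolynomials

open Literature.NumberTheory.LFunctions Polynomial Finset
open scoped BigOperators Nat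

/-! ## 1. Hyperbolicity ranges (all RH-FREE) -/

/-- Schema: **explicit cubic shift-threshold law** — for `d ≥ 3`, `n ≥ n₀` and `p·d³ ≤ q·n`, `J^{d,n}_γ` is
hyperbolic (`Splits` over `ℝ`). RH-FREE. -/
def CubicThresholdLaw (γ : ℕ → ℝ) (p q n₀ : ℕ) : Prop :=
  ∀ d n : ℕ, 3 ≤ d → n₀ ≤ n → p * d ^ 3 ≤ q * n → (jensenPoly γ d n).Splits

/-- **RH-FREE. Rung J-P (P1): THEOREM α as a kernel statement.** For every `d ≥ 3` and every
`n ≥ max(10⁴, ⌈0.135·d³⌉)` (`0.135 = 27/200`), `J^{d,n}_γ`, `γ = xiTaylorCoeff`, is hyperbolic.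
Status: CERTIFIED (CAL) by the closed jensen track (rh-explicit/jensen/CLOSE-NOTE §2, 2026-08-22: TABLE Z =
kit j163057 + FAR-CELL, LEMMA R/L1, two lineages, `c = 0.13497` floor-bound at `d = 42`); NOT a tree theorem.
Implied by tree theorems for `d ≤ 10¹⁰` (all shifts, RH to height); NEW as a statement only for `d > 10¹⁰`
(tree) / `d > 9.001·10²⁴` (print, GORTTW + Platt–Trudgian); its CONTENT is the zero-free, height-free
mechanism and the first all-degree numeric threshold. Inside Farmer's barrier class. -/
@[conjecture] def TheoremAlpha : Prop :=
  CubicThresholdLaw xiTaylorCoeff 27 200 10000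

/-- Schema: **explicit exponential shift-threshold law** `n ≥ B^{d+1}` ⇒ `J^{d,n}_γ` hyperbolic (`d ≥ 1`). RH-FREE. -/
def ExpThresholdLaw (γ : ℕ → ℝ) (B : ℕ) : Prop :=
  ∀ d n : ℕ, 1 ≤ d → B ^ (d + 1) ≤ n → (jensenPoly γ d n).Splits

/-- **RH-FREE. P0: explicit GORTTW for `ξ` with base `1100`** (`∀ d ≥ 1, n ≥ 1100^{d+1}`). Implied by P0′
(`10^{2d+5} ≤ 1100^{d+1}` for `d ≥ 2`; `d = 1` tree) and by THEOREM α; a corollary of the tree for `d ≤ 10¹⁰`.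
"First fully explicit kernel all-degree threshold" — never "range improvement". -/
@[conjecture] def ExplicitGORTTW1100 : Prop :=
  ExpThresholdLaw xiTaylorCoeff 1100

/-- **RH-FREE. P0′ — the prover seat's kernel headline (`Literature…JensenXiExponentialRange`,
`jensenPoly_xiTaylorCoeff_splits_of_pow_le`; chain 8/10 accepted 2026-08-25, headline landing after p404296 +
p402931): for every `d ≥ 1` and `n ≥ 10^{2d+5}`, `J^{d,n}_γ` is hyperbolic.** Zero-free mechanism (Gauss
weight, Laguerre–Sonin integral, explicit error terms) in the kernel for ALL `d`; statement-wise below THEOREM α. -/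
@[conjecture] def ExplicitGORTTWPow10 : Prop :=
  ∀ d n : ℕ, 1 ≤ d → 10 ^ (2 * d + 5) ≤ n → (jensenPoly xiTaylorCoeff d n).Splits

/-- **RH-FREE. P6-range: `∀ d ≥ 3, ∀ n ≥ 2d³`, `J^{d,n}_γ` is hyperbolic** — the hyperbolicity COROLLARY of the
round-4 certificate target `HermiteSignTestCubic` (§3; HOME-PROVED `splits_of_hermiteSignTestCubic` via the
soundness S-H2 and `XiDeltaSqPos`). Cubic like THEOREM α (constant `2` instead of `0.135`, no `10⁴` floor), with a
parameter-free mechanism (the Hermite skeleton) instead of CAL constants. For `n < 10⁴` (`d ≤ 17`) it is inside the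
tree's height-bought region; it is nowhere implied RH-freely by a tree theorem. -/
@[conjecture] def JensenCubicRangeTwo : Prop :=
  CubicThresholdLaw xiTaylorCoeff 2 1 0

/-! ## 2. GORTTW's frame as functions of a coefficient sequence `γ` [GriffinEtAl2022, §2] -/

/-- Downward window ratios `r̃_k(M) := γ(M−k)·γ(M)^{k−1}/γ(M−1)^k` (`1 ≤ k ≤ M`; `r̃₁ = 1`). -/
def windowSeqDown (γ : ℕ → ℝ) (M k : ℕ) : ℝ :=
  γ (M - k) * γ M ^ (k - 1) / γ (M - 1) ^ k

/-- GORTTW's uniformizer squared `Δ(M)² := (1 − γ(M−2)γ(M)/γ(M−1)²)/2` [GriffinEtAl2022, (2.2)]. -/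
def gorttwDeltaSq (γ : ℕ → ℝ) (M : ℕ) : ℝ := (1 - windowSeqDown γ M 2) / 2

/-- `Δ(M) := √(Δ(M)²)`. -/
def gorttwDelta (γ : ℕ → ℝ) (M : ℕ) : ℝ := Real.sqrt (gorttwDeltaSq γ M)

/-- `r(M) := γ(M−1)/γ(M)`, the inner scale of GORTTW's substitution. -/
def gorttwR (γ : ℕ → ℝ) (M : ℕ) : ℝ := γ (M - 1) / γ M

/-- Third downward cumulant `ũ₃(M) := r̃₃ − 3r̃₂ + 2`. -/
def gorttwU3 (γ : ℕ → ℝ) (M : ℕ) : ℝ := windowSeqDown γ M 3 - 3 * windowSeqDown γ M 2 + 2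

/-- Squared Hermite-frame skewness `Ũ₃(M)² := ũ₃(M)²/Δ(M)⁶`. -/
def gorttwSkewSq (γ : ℕ → ℝ) (M : ℕ) : ℝ := gorttwU3 γ M ^ 2 / gorttwDeltaSq γ M ^ 3

/-- **The one function of the column**: `q(M) := M·Ũ₃(M)²`. For `γ = xiTaylorCoeff`: `q(10) = 1.569`,
`q(100) = 7.754`, `q(10³) = 13.43`, `q(10⁴) = 17.40`, `q(135000) = 20.39`, increasing on every computed
`M ≤ 135000`; all-orders prediction `q(M) = Q₀(τ) + O(1/M)`, `τe^{4τ} = M/2π`, `Q₀ ↑ 32` (HOME §8.3). RH-free. -/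
def gorttwQ (γ : ℕ → ℝ) (M : ℕ) : ℝ := (M : ℝ) * gorttwSkewSq γ M

/-- Explicit skewness law (schema, RH-free): `q(M) < Q` for all `M ≥ M₀`. (`XiSkewLaw 3 32` = S-T6 is the
structural conjecture of the column; `XiSkewLaw 3 36` = S-T3 is CAL-certifiable; neither is a target.) -/
def XiSkewLaw (M₀ : ℕ) (Q : ℝ) : Prop := ∀ M : ℕ, M₀ ≤ M → gorttwQ xiTaylorCoeff M < Q

/-- **S-T5 (RH-FREE; in print: the strict Turán inequalities `γ(M−1)² > γ(M−2)γ(M)` of the Taylor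
coefficients of `ξ`, Csordas–Norfolk–Varga 1986, zero-free proof; in the tree so far only height-bought):**
`Δ(M)² > 0` for every `M ≥ 2`. Equivalent (HOME-PROVED `xiDeltaSqPos_iff_tiltedVarBound`) to the tilted-moment
variance bound `XiTiltedVarBound`. A support of the route, never a target. -/
@[conjecture] def XiDeltaSqPos : Prop := ∀ M : ℕ, 2 ≤ M → 0 < gorttwDeltaSq xiTaylorCoeff M

/-- Hermite coordinate functional for the tree's `gorzHermite k` (`= H_k(X/2)`): the coefficient of
`gorzHermite k` in `p` [DLMF 18.18.20 at `X/2`]. -/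
def hermiteCoord (p : ℝ[X]) (k : ℕ) : ℝ :=
  ∑ i ∈ range (p.natDegree + 1), p.coeff (k + 2 * i) * (((k + 2 * i)! : ℝ) / ((i ! : ℝ) * (k ! : ℝ)))

/-- GORTTW's outer constant `(γ(M)·r(M)^d·Δ(M)^d)⁻¹`, `M = n + d`. -/
def gorttwA (γ : ℕ → ℝ) (d n : ℕ) : ℝ :=
  (γ (n + d) * gorttwR γ (n + d) ^ d * gorttwDelta γ (n + d) ^ d)⁻¹

/-- **GORTTW's normalised Jensen polynomial** `J̃^{d,n}(X) := A·J^{d,n}(r(ΔX − 1))` [GriffinEtAl2022, (2.4)]. -/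
def gorttwNormalised (γ : ℕ → ℝ) (d n : ℕ) : ℝ[X] :=
  C (gorttwA γ d n) * (jensenPoly γ d n).comp
    (C (gorttwR γ (n + d) * gorttwDelta γ (n + d)) * X + C (-gorttwR γ (n + d)))

/-- GORTTW's Hermite coefficients `c_{d,n,j}` := coefficient of `H_{d−j}(X/2)` in `J̃^{d,n}` [GriffinEtAl2022,
Lemma 2.4] (`c₀ = 1`, `c₁ = c₂ = 0`: HOME-PROVED frame identity `gorttwFrame_holds`). -/
def gorttwCoeff (γ : ℕ → ℝ) (d n : ℕ) (j : ℕ) : ℝ := hermiteCoord (gorttwNormalised γ d n) (d - j)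

/-! ## 3. The Hermite sign test (P6) and its supports -/

/-- Outer test abscissa `B_d := 2√(2d+1) + 2` (beyond every zero of `H_d(X/2)`: S-H1). -/
def hermiteTestBound (d : ℕ) : ℝ := 2 * Real.sqrt (2 * d + 1) + 2

/-- **The Hermite SIGN TEST (RH-free, mechanism-bearing; NOT implied by hyperbolicity)**: `J̃^{d,n}_γ` has the
sign of `H_d(X/2)` at every zero of `H_{d−1}(X/2)`, is positive at `B_d` and has sign `(−1)^d` at `−B_d`
(`d + 1` prescribed sign conditions ⇒ `d` real zeros, S-H2). -/
def HermiteSignTest (γ : ℕ → ℝ) (d n : ℕ) : Prop :=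
  (∀ x : ℝ, (gorzHermite (d - 1)).eval x = 0 →
      0 < (gorttwNormalised γ d n).eval x * (gorzHermite d).eval x) ∧
    0 < (gorttwNormalised γ d n).eval (hermiteTestBound d) ∧
    0 < (-1 : ℝ) ^ d * (gorttwNormalised γ d n).eval (-hermiteTestBound d)

/-- Explicit Hermite sign-test law (schema, RH-free): the test holds whenever `d ≥ 3`, `n ≥ n₀`, `p·d³ ≤ q·n`. -/
def HermiteSignTestLaw (γ : ℕ → ℝ) (p q n₀ : ℕ) : Prop :=
  ∀ d n : ℕ, 3 ≤ d → n₀ ≤ n → p * d ^ 3 ≤ q * n → HermiteSignTest γ d n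

/-- **RH-FREE. P6 — THE PROOF-OF-DATA TARGET OF ROUND 4 (Hermite sign-test law, CUBIC, `n ≥ 2d³`),
certificate form; referee rh-jensen-ref2 g7 PASS («not RH re-indexed»).** `∀ d ≥ 3, ∀ n ≥ 2d³`: the Hermite
sign test holds for `J̃^{d,n}_ξ`. Mechanism-bearing (sign conditions at `d + 1` specified abscissae; no zero-free
region gives them); parameter-free threshold law `M_HS(d) ≈ q(M)·d³/32 ≤ 0.65d³` (HOME THEORY §10), measured
`n_HS(d)/d³ ≤ 0.277` (`d ≤ 33`); pin margin `≥ 3`. Kernel blueprint HOME-PROVED: `SignTestBlueprint ρ` for every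
table `ρ`, so P6 follows from S-T5 + S-H3(ρ) + S-C(ρ) for ONE admissible `ρ` (the route's choice: `rhoWin`). -/
@[conjecture] def HermiteSignTestCubic : Prop := HermiteSignTestLaw xiTaylorCoeff 2 1 0

/-- Support **S-H1 (ξ-free, classical; Szegő (6.31.19)) — HOME-PROVED (`hermiteZeroBound_holds`)**: every zero of
`H_d(X/2)` lies in `(−2√(2d+1), 2√(2d+1))`. -/
def HermiteZeroBound : Prop :=
  ∀ d : ℕ, ∀ x : ℝ, (gorzHermite d).eval x = 0 → |x| < 2 * Real.sqrt (2 * d + 1)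

/-- Support **S-H2 (ξ-free SOUNDNESS of the Hermite sign test) — HOME-PROVED (`hermiteSignTestSound_holds`)**: for
`d ≥ 3` and a non-degenerate frame, the test implies `J^{d,n}_γ` is hyperbolic, for ANY real `γ`. -/
def HermiteSignTestSound : Prop :=
  ∀ (γ : ℕ → ℝ) (d n : ℕ), 3 ≤ d → gorttwA γ d n ≠ 0 →
    gorttwR γ (n + d) * gorttwDelta γ (n + d) ≠ 0 → HermiteSignTest γ d n → (jensenPoly γ d n).Splits

/-- Support schema **S-H3 (ξ-free): explicit Hermite critical-ratio bounds** — at every zero `y` of `H_{d−1}(X/2)`,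
`|H_{d−j}(y/·)| ≤ ρ(d,j)·|H_d(·)|` in the tree's `gorzHermite` normalisation, `1 ≤ j ≤ d`. -/
def HermiteCriticalRatioBound (ρ : ℕ → ℕ → ℝ) : Prop :=
  ∀ (d j : ℕ) (y : ℝ), 1 ≤ j → j ≤ d → (gorzHermite (d - 1)).eval y = 0 →
    |(gorzHermite (d - j)).eval y| ≤ ρ d j * |(gorzHermite d).eval y|

/-- **The Turán-energy table (HOME-PROVED admissible: `hermiteCriticalRatioBound_turan : HermiteCriticalRatioBound
rhoHT`)**: rows `j ≤ 4` exact/sharp, rows `j ≥ 5` from the Turán determinant energy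
`D_m = G_{m+1}² − G_mG_{m+2}`; loses `≍ √d` per fixed `j ≥ 5` (so `XiGorttwCoeffSmall rhoHT` is predicted FALSE as
an all-`d` statement — per-cell use only). -/
def rhoHT (d j : ℕ) : ℝ :=
  if j ≤ 1 then 0
  else if j = 2 then 1 / (2 * ((d : ℝ) - 1))
  else if j = 3 then Real.sqrt (2 * (d : ℝ) - 1) / (2 * ((d : ℝ) - 1) * ((d : ℝ) - 2))
  else if j = 4 then 3 * (d : ℝ) / (4 * ((d : ℝ) - 1) * ((d : ℝ) - 2) * ((d : ℝ) - 3))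
  else Real.sqrt (((d - j)! : ℝ) / (2 ^ j * ((d - 1)! : ℝ)))

/-- **The WINDOW table `ρ_win` (S-H3-win; PROVABLE NOW, proof in HOME THEORY-JENSEN.md §10.6):** rows `j ≤ 4` and
the energy rows as in `rhoHT` (PROVED, HOME §8.8); in the window `5 ≤ j`, `4(j−2)³ ≤ d` the double-root row
`(6/5)(j−1)(2d)^{−j/2}`.  Proof of the window rows (elementary, ξ-free): at a zero `y` of `G_{d−1}` put
`t = y/√(2d)` (`|t| < 2` by S-H1) and `q_i = (2d)^{i/2} G_{d−2−i}(y)/G_{d−2}(y)`; then `q_{i+1} = (d/(d−2−i))(t q_i − q_{i−1})`,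
`|G_{d−j}/G_d|·(2d)^{j/2}/(j−1) = |q_{j−2}|·d/((d−1)(j−1))`, and writing `q_i = P_i u_i`, `P_i = ∏_{m<i} d/(d−2−m)`,
`u_{i+1} = t u_i − ((d−1−i)/d) u_{i−1}`, variation of constants against Chebyshev's `U_i(t/2)` (`|U_i| ≤ i+1`) gives
`|u_i| ≤ (i+1)(1 + (25/24)(i−1)i(i+2)/(12d)) ≤ (25/24)(i+1)` and `P_i ≤ exp(i(i+3)/(2(d−1−i))) ≤ e^{0.0866}` on the window,
so the ratio is `≤ 1.0289·1.0904·(108/107)·(j−1)(2d)^{−j/2} < 1.133·(j−1)(2d)^{−j/2}`.  (The wider window `2j² ≤ 3d` of the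
round-4 draft table `ρ♯` is TRUE numerically to `d = 2048`, min slack `1.238`, but near its edge no zero-location bound short
of the exact Airy asymptotics suffices — dropped as gratuitous difficulty; the cost in the `ℓ¹` sums is `< 0.15` absolute,
felt only for `60 ≲ d < 256`.) -/
def rhoWin (d j : ℕ) : ℝ :=
  if j ≤ 4 then rhoHT d j
  else if 4 * (j - 2) ^ 3 ≤ d then 6 / 5 * ((j : ℝ) - 1) / (2 * (d : ℝ)) ^ ((j : ℝ) / 2)
  else rhoHT d j

/-- Schema **S-C (coefficient smallness for `ξ` on the pin `n ≥ 2d³`, w.r.t. a table `ρ`)**: the two weighted `ℓ¹`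
sums of GORTTW's Hermite coefficients `c_{d,n,j}`, `j ≥ 1`, are `< 1`. Numbers (HOME, banked 90-digit table, lineage L1):
with `rhoWin` (= `rhoHT` for `d < 108`) the first sum is `0.34–0.39` on the pin for `d ≤ 17`; model limit with the window
rows `(3s−1)eˢ + 1 ≈ 0.63`, `s = √q/24`, `q < 32`; the second sum is `≤ 0.1`. -/
def XiGorttwCoeffSmall (ρ : ℕ → ℕ → ℝ) : Prop :=
  ∀ d n : ℕ, 3 ≤ d → 2 * d ^ 3 ≤ n →
    (∑ j ∈ range d, |gorttwCoeff xiTaylorCoeff d n (j + 1)| * ρ d (j + 1) < 1) ∧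
    (∑ j ∈ range d, |gorttwCoeff xiTaylorCoeff d n (j + 1)| * (2 / hermiteTestBound d) ^ (j + 1) < 1)

/-- S-C restricted to the shifts `n < N` — for `N = 10⁴` a FINITE set of cells (`d ≤ 17`): the TABLE regime
(kernel closure needs certified enclosures of `γ(m)`, `m ≤ N + 17`, as kernel facts or as an enclosure hypothesis in the
pattern of `JensenXiDegEightBallsA` — the evidence-class question J-n2/J-n4 is part of this statement's difficulty). -/
def XiGorttwCoeffSmallBelow (ρ : ℕ → ℕ → ℝ) (N : ℕ) : Prop :=
  ∀ d n : ℕ, 3 ≤ d → 2 * d ^ 3 ≤ n → n < N →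
    (∑ j ∈ range d, |gorttwCoeff xiTaylorCoeff d n (j + 1)| * ρ d (j + 1) < 1) ∧
    (∑ j ∈ range d, |gorttwCoeff xiTaylorCoeff d n (j + 1)| * (2 / hermiteTestBound d) ^ (j + 1) < 1)

/-- S-C restricted to the shifts `n ≥ N` — for `N = 10⁴` the ANALYTIC regime (`M = n + d ≥ 10⁴`: tilted-Gaussian /
Laplace asymptotics of the window cumulants of `γ` with explicit constants, uniform in `d`). -/
def XiGorttwCoeffSmallFrom (ρ : ℕ → ℕ → ℝ) (N : ℕ) : Prop :=
  ∀ d n : ℕ, 3 ≤ d → 2 * d ^ 3 ≤ n → N ≤ n →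
    (∑ j ∈ range d, |gorttwCoeff xiTaylorCoeff d n (j + 1)| * ρ d (j + 1) < 1) ∧
    (∑ j ∈ range d, |gorttwCoeff xiTaylorCoeff d n (j + 1)| * (2 / hermiteTestBound d) ^ (j + 1) < 1)

/-- Regime glue (kernel, trivial): the two regimes give S-C. -/
theorem xiGorttwCoeffSmall_of_split {ρ : ℕ → ℕ → ℝ} {N : ℕ} (hB : XiGorttwCoeffSmallBelow ρ N)
    (hF : XiGorttwCoeffSmallFrom ρ N) : XiGorttwCoeffSmall ρ := by
  intro d n hd hn
  rcases lt_or_ge n N with h | h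
  · exact hB d n hd hn h
  · exact hF d n hd hn h

/-- Below `d = 108` the window table IS the Turán-energy table (no window rows). -/
theorem rhoWin_eq_rhoHT_of_lt {d : ℕ} (hd : d < 108) (j : ℕ) : rhoWin d j = rhoHT d j := by
  unfold rhoWin
  by_cases h4 : j ≤ 4
  · rw [if_pos h4]
  · rw [if_neg h4]
    have : ¬ 4 * (j - 2) ^ 3 ≤ d := by
      intro h
      have hj : 3 ≤ j - 2 := by omega
      have : 27 ≤ (j - 2) ^ 3 := by
        calc 27 = 3 ^ 3 := by norm_num
          _ ≤ (j - 2) ^ 3 := Nat.pow_le_pow_left hj 3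
      omega
    rw [if_neg this]

/-- Bound-row constants (HOME v4.4 §8.11, PROVED there): from the explicit damped-recurrence polynomials
`u₃ = t³ − (2 − 5/d)t`, `u₄ = t⁴ − (3 − 9/d)t² + 1 − 6/d + 8/d²` one has `|u₃| ≤ 4 + 10/d`, `|u₄| ≤ 5 + 30/d + 8/d²` on
`|t| ≤ 2` (sharp at `t = 2`), whence `|H_{d−5}/H_{d−1}|(2y) ≤ bndRow5(d)(2d)^{−5/2}` (`d ≥ 8`) and
`|H_{d−6}/H_{d−1}|(2y) ≤ bndRow6(d)(2d)^{−3}` (`d ≥ 9`) at every critical point; `bndRow5 ↓ 4`, `bndRow6 ↓ 5`. -/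
def bndRow5 (d : ℝ) : ℝ := (4 * d + 10) * d ^ 3 / ((d - 1) * (d - 2) * (d - 3) * (d - 4))

/-- See `bndRow5`. -/
def bndRow6 (d : ℝ) : ℝ := (5 * d ^ 2 + 30 * d + 8) * d ^ 3 / ((d - 1) * (d - 2) * (d - 3) * (d - 4) * (d - 5))

/-- The route's table **ρ_win⁺⁺ = `rhoWinMin`** (HOME v4.4 §8.11: `HermiteCriticalRatioBound rhoWinMin` PROVED, ξ-free, every `d`):
rows `j ≤ 4` = `rhoHT`; rows 5, 6 = `min(energy row, bound-row)` for `d ≥ 8`, `9` (no thresholds); the double-root window row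
`(6/5)(j−1)(2d)^{−j/2}` on `4(j−2)³ ≤ d`; energy rows elsewhere.  Pointwise `rhoWinMin ≤ rhoWin` (rows 5, 6 only get smaller:
`bndRow5 ≤ 24/5` from `d ≥ 70`, `bndRow6 ≤ 6` from `d ≥ 116`, below the window thresholds 108 / 256), so every smallness certificate
w.r.t. `rhoWin` transfers a fortiori; the gain is on the analytic side (HOME THEORY §10.8 (8): the cumulant-majorant route to
`XiGorttwCoeffSmallFrom` has margin 0.21 at envelope constant `A = 17/16` with this table, versus none with `rhoWin`). -/
def rhoWinMin (d j : ℕ) : ℝ :=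
  if j ≤ 4 then rhoHT d j
  else if j = 5 ∧ 8 ≤ d then min (rhoHT d j) (bndRow5 d / (2 * (d : ℝ)) ^ ((j : ℝ) / 2))
  else if j = 6 ∧ 9 ≤ d then min (rhoHT d j) (bndRow6 d / (2 * (d : ℝ)) ^ ((j : ℝ) / 2))
  else if 4 * (j - 2) ^ 3 ≤ d then 6 / 5 * ((j : ℝ) - 1) / (2 * (d : ℝ)) ^ ((j : ℝ) / 2)
  else rhoHT d j

/-- Below the first bound-row threshold (`d < 8`) the route's table `rhoWinMin` coincides with the Hermite–Turán
table `rhoHT` row by row (the window row needs `4(j−2)³ ≤ d`, impossible for `j ≥ 5`, `d < 8`). -/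
theorem rhoWinMin_eq_rhoHT_of_lt {d : ℕ} (hd : d < 8) (j : ℕ) : rhoWinMin d j = rhoHT d j := by
  unfold rhoWinMin
  by_cases h4 : j ≤ 4
  · rw [if_pos h4]
  · rw [if_neg h4]
    have h5 : ¬ (j = 5 ∧ 8 ≤ d) := by omega
    have h6 : ¬ (j = 6 ∧ 9 ≤ d) := by omega
    rw [if_neg h5, if_neg h6]
    have : ¬ 4 * (j - 2) ^ 3 ≤ d := by
      intro h
      have hj : 3 ≤ j - 2 := by omega
      have : 27 ≤ (j - 2) ^ 3 := by
        calc 27 = 3 ^ 3 := by norm_num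
          _ ≤ (j - 2) ^ 3 := Nat.pow_le_pow_left hj 3
      omega
    rw [if_neg this]

/-- **P6's kernel BLUEPRINT as a statement (HOME-PROVED for EVERY table `ρ`: `hermiteSignTestCubic_of_laws₀`,
from the frame identity S-T0 `gorttwFrame_holds`, S-H1 and the expansion lemma):** strict Turán positivity +
an admissible critical-ratio table + coefficient smallness w.r.t. that table ⇒ the cubic sign-test law. -/
def SignTestBlueprint (ρ : ℕ → ℕ → ℝ) : Prop :=
  XiDeltaSqPos → HermiteCriticalRatioBound ρ → XiGorttwCoeffSmall ρ → HermiteSignTestCubic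

/-- **Glue of record (kernel, trivial): soundness + strict Turán positivity + positivity of `γ` turn the certificate
P6 into the range statement `JensenCubicRangeTwo`.** The non-degeneracy of GORTTW's frame for `ξ`
(`A ≠ 0`, `rΔ ≠ 0`) is where `XiDeltaSqPos` and `0 < γ(n)` (tree fact `xiTaylorCoeff_pos`, proved:
`xiTaylorCoeff_pos_holds`, `XiMoments.lean`) enter. -/
theorem jensenCubicRangeTwo_of (hS : HermiteSignTestSound) (hΔ : XiDeltaSqPos)
    (hpos : xiTaylorCoeff_pos) (h6 : HermiteSignTestCubic) : JensenCubicRangeTwo := by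
  intro d n hd hn0 hdn
  have hM : 2 ≤ n + d := by omega
  have hγM : 0 < xiTaylorCoeff (n + d) := hpos _
  have hγM1 : 0 < xiTaylorCoeff (n + d - 1) := hpos _
  have hR : 0 < gorttwR xiTaylorCoeff (n + d) := by
    unfold gorttwR; exact div_pos hγM1 hγM
  have hDelta : 0 < gorttwDelta xiTaylorCoeff (n + d) := by
    unfold gorttwDelta; exact Real.sqrt_pos.mpr (hΔ _ hM)
  have hA : gorttwA xiTaylorCoeff d n ≠ 0 := by
    unfold gorttwA; exact inv_ne_zero (by positivity)
  have hB : gorttwR xiTaylorCoeff (n + d) * gorttwDelta xiTaylorCoeff (n + d) ≠ 0 := by positivity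
  exact hS xiTaylorCoeff d n hd hA hB (h6 d n hd hn0 hdn)

end Summit.RiemannHypothesis.RiemannHypothesis.Theorems.JensenPolynomials
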